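import Summits.RiemannHypothesis.RiemannHypothesis.Theorems.OddSectorOddOneSignedWindowsOddEulerLagrange
import HarnessLib

/-!
# Odd-sector window-Lipschitz, PART 1: the weak Euler–Lagrange equation of an odd-sector ground state
# against EVERY finite-energy window direction (pub-rhpf, transport-1, leaf G1.22 'TRANSPORT'; RH-free; def-free)

**mechanism/rigidity campaign; no RH claims.**  Companion text:
`run/shared/lean/pub/pub-rhpf/pub-rhpf-transport-1/TRANSPORT.md` §23 (odd-sector window-Lipschitz).

Target of the series: the odd-sector twin of the PROVED `WeilWindowFlow.WindowLipschitz`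
(`WindowLipschitz_proof`), i.e. `ε_od = weilOddGroundEnergy` is locally Lipschitz on `(0, ∞)` — the named
residual `hoL` of `PfPersistenceParityTransport.splittingLeakage_iff_noParityCrossing_of_oddWindowLipschitz`
((115), PART 11).  The even chain's spine (Feulefack–Jarohs–Weth sup bound, IMS cut, barrier edge law) tests
the weak Euler–Lagrange identity of the ground state against NON-ODD directions (truncations `(Re ζu − c)₊`,
cut-offs `χ²u` times barriers).  The odd-sector identity in the tree
(`OddSector.oddGroundState_eulerLagrange_formDomain`) is stated for ODD directions only.  This file removes
that restriction:

* `oddGroundState_eulerLagrange_all` — for an odd-sector ground state `u` at the window `a` and EVERY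
  `w ∈ L²` vanishing a.e. off `[-a, a]` with integrable archimedean energy density,
  `P(u, w) + Σ_{log n < 2a} Λ(n) n^{-1/2} D_{log n}(u, w) + ∫₀^∞ ρ(t) D_t(u, w) dt − M_a⟨u, w⟩ = ε_od(a)⟨u, w⟩`.

Proof (reflection symmetry, no new analysis): the sesquilinear form `B(u, ·)` of the identity is odd under
the reflection `w ↦ w(−·)` when `u` is odd a.e. — termwise: `∫ u ch = 0`, `∫ w(−x) sh(x/2) = −∫ w sh`,
`D_t(u, w(−·)) = −D_t(u, w)` (substitution `x ↦ −x − t`), `⟨u, w(−·)⟩ = −⟨u, w⟩` — so for the odd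
finite-energy window direction `v = w − w(−·)` every term of `B(u, v)` is twice the corresponding term of
`B(u, w)`, and the odd identity for `v` is the identity for `w`.
* `oddGroundState_finiteEnergy'` — (C2) in the shape used by the even chain
  (`… ≤ (M_a + ε_od(a)) ∫‖u‖²`, `∫‖u‖² = 1`).

Labels: PROVED tree material only (RH-free, ζ enters through `Λ` in the closed form as in the whole
`WeilWindowFlow` chain); no hypothesis is an open item.  Nothing here is a step toward RH.

References: E. Bombieri, Rend. Mat. Acc. Lincei (9) 11 (2000), §4 Lemma 1 (4.2), §9 Lemma 11 (parity
splitting of the form); M. Reed, B. Simon, *Methods of Modern Mathematical Physics IV* (1978), §XIII.1.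
-/

set_option linter.dupNamespace false  -- D-0017 nested layout: `RiemannHypothesis.RiemannHypothesis`

noncomputable section

open MeasureTheory Set Filter
open scoped Topology ENNReal NNReal ComplexConjugate

namespace Summit.RiemannHypothesis.RiemannHypothesis.Theorems.OddSectorWindowLipschitz

open Literature.NumberTheory.LFunctions
open Summit.RiemannHypothesis.RiemannHypothesis.Theorems.OddSector
  (oddGroundState_eulerLagrange_formDomain oddGroundState_finiteEnergy integral_mul_cosh_eq_zero_of_ae_odd)

/-! ### (C2) in the shape of the even chain -/

/-- **(C2), odd sector**: for every window `a` and every odd-sector ground state `u` at `a`, the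
archimedean energy density is integrable on `(0, ∞)` and `P(u) + 𝓔_a(u) ≤ (M_a + ε_od(a)) ∫‖u‖²`
(`∫‖u‖² = 1`; the shape of `WeilWindowFlowWindowLipschitz.stub_groundStateEnergy`).
[cite: Bombieri2000Weil, §4 Thm 3 (proof) and Thm 5] -/
theorem oddGroundState_finiteEnergy' :
    ∀ (a : ℝ) (u : ℝ → ℂ), IsWeilOddGroundState a u →
      IntegrableOn (fun t ↦ weilArchDensity t * weilIncrement u t) (Ioi 0) ∧
        weilPoleForm u + weilDirichletEnergy a u ≤
          (weilMarkovConstant a + weilOddGroundEnergy a) * ∫ x, ‖u x‖ ^ 2 := by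
  intro a u hu
  obtain ⟨h1, h2⟩ := oddGroundState_finiteEnergy a u hu
  refine ⟨h1, ?_⟩
  rw [hu.integral_norm_sq, mul_one]
  exact h2

/-! ### Toolkit: measurability, integrability, reflections -/

/-- The archimedean density `ρ` is measurable. -/
private theorem elAll_measurable_weilArchDensity : Measurable weilArchDensity := by
  unfold weilArchDensity
  exact (Real.continuous_exp.comp (continuous_id.div_const 2)).measurable.div
    (continuous_const.mul Real.continuous_sinh).measurable

/-- The increment field `(t, x) ↦ v(x + t) − v(x)` of an a.e.-strongly measurable `v` is jointly
a.e.-strongly measurable. -/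
private theorem elAll_aesm_field {v : ℝ → ℂ} (hv : AEStronglyMeasurable v volume) :
    AEStronglyMeasurable (fun p : ℝ × ℝ ↦ v (p.2 + p.1) - v p.2)
      ((volume : Measure ℝ).prod (volume : Measure ℝ)) :=
  (hv.comp_quasiMeasurePreserving (quasiMeasurePreserving_add_swap volume volume)).sub
    (hv.comp_quasiMeasurePreserving Measure.quasiMeasurePreserving_snd)

/-- The increment form `t ↦ D_t(v)` of an a.e.-strongly measurable `v` is a.e.-strongly measurable. -/
private theorem elAll_aesm_weilIncrement {v : ℝ → ℂ} (hv : AEStronglyMeasurable v volume) :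
    AEStronglyMeasurable (weilIncrement v) volume :=
  ((continuous_pow 2).comp_aestronglyMeasurable (elAll_aesm_field hv).norm).integral_prod_right'

/-- The difference of a translate and the function is in `L²`. -/
private theorem elAll_memLp_field {v : ℝ → ℂ} (hv : MemLp v 2) (t : ℝ) :
    MemLp (fun x ↦ v (x + t) - v x) 2 :=
  (hv.comp_measurePreserving (measurePreserving_add_right volume t)).sub hv

/-- The polarised increment integrand of two `L²` functions is integrable. -/
private theorem elAll_integrable_cross {v w : ℝ → ℂ} (hv : MemLp v 2) (hw : MemLp w 2) (t : ℝ) :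
    Integrable fun x ↦ (v (x + t) - v x) * conj (w (x + t) - w x) :=
  (elAll_memLp_field hv t).integrable_mul (ConnesVanSuijlekom.memLp_conj (elAll_memLp_field hw t))

/-- An `L²` function vanishing a.e. off `[-a, a]` is integrable against every continuous weight. -/
private theorem elAll_integrable_mul_continuous {v : ℝ → ℂ} {a : ℝ} (hv : MemLp v 2)
    (hv0 : ∀ᵐ x : ℝ, x ∉ Icc (-a) a → v x = 0) {φ : ℝ → ℂ} (hφ : Continuous φ) :
    Integrable fun x ↦ v x * φ x :=
  (IntegrableOn.mul_continuousOn ((hv.restrict (Icc (-a) a)).integrable one_le_two)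
    hφ.continuousOn isCompact_Icc).integrable_of_ae_notMem_eq_zero
      (hv0.mono fun x hx hxs ↦ by simp [hx hxs])

/-- The reflection of a function vanishing a.e. off the symmetric window vanishes a.e. off it. -/
private theorem elAll_reflect_support {w : ℝ → ℂ} {a : ℝ}
    (hw0 : ∀ᵐ x : ℝ, x ∉ Icc (-a) a → w x = 0) :
    ∀ᵐ x : ℝ, x ∉ Icc (-a) a → w (-x) = 0 := by
  have h : ∀ᵐ x : ℝ, -x ∉ Icc (-a) a → w (-x) = 0 :=
    (Measure.measurePreserving_neg (volume : Measure ℝ)).quasiMeasurePreserving.tendsto_ae.eventually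
      hw0
  filter_upwards [h] with x hx hxI
  refine hx fun hm ↦ hxI ?_
  rw [mem_Icc] at hm ⊢
  constructor <;> linarith [hm.1, hm.2]

/-- `∫ w(−x) sinh(x/2) dx = −∫ w(x) sinh(x/2) dx`. -/
private theorem elAll_sinh_reflect (w : ℝ → ℂ) :
    ∫ x, w (-x) * (Real.sinh (x / 2) : ℂ) = -∫ x, w x * (Real.sinh (x / 2) : ℂ) := by
  calc ∫ x, w (-x) * (Real.sinh (x / 2) : ℂ)
      = ∫ x, w (-(-x)) * (Real.sinh (-x / 2) : ℂ) :=
        (integral_neg_eq_self (fun x ↦ w (-x) * (Real.sinh (x / 2) : ℂ)) volume).symm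
    _ = ∫ x, -(w x * (Real.sinh (x / 2) : ℂ)) := by
        refine integral_congr_ae (Eventually.of_forall fun x ↦ ?_)
        simp only [neg_neg, neg_div, Real.sinh_neg, Complex.ofReal_neg, mul_neg]
    _ = -∫ x, w x * (Real.sinh (x / 2) : ℂ) := integral_neg _

/-- `⟨u, w(−·)⟩ = −⟨u, w⟩` for `u` odd a.e. -/
private theorem elAll_inner_reflect {u w : ℝ → ℂ} (huo : ∀ᵐ x : ℝ, u (-x) = -u x) :
    ∫ x, u x * conj (w (-x)) = -∫ x, u x * conj (w x) := by
  calc ∫ x, u x * conj (w (-x))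
      = ∫ x, u (-x) * conj (w (-(-x))) :=
        (integral_neg_eq_self (fun x ↦ u x * conj (w (-x))) volume).symm
    _ = ∫ x, -(u x * conj (w x)) := by
        refine integral_congr_ae ?_
        filter_upwards [huo] with x hx
        rw [neg_neg, hx, neg_mul]
    _ = -∫ x, u x * conj (w x) := integral_neg _

/-- **Reflection of the polarised increment against an odd state**: for `u` odd a.e. and every `t`,
`D_t(u, w(−·)) = −D_t(u, w)` (substitution `x ↦ −x − t`; translates of null sets are null). -/
private theorem elAll_cross_reflect {u w : ℝ → ℂ} (huo : ∀ᵐ x : ℝ, u (-x) = -u x) (t : ℝ) :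
    ∫ x, (u (x + t) - u x) * conj (w (-(x + t)) - w (-x)) =
      -∫ x, (u (x + t) - u x) * conj (w (x + t) - w x) := by
  have hut : ∀ᵐ y : ℝ, u (-(y + t)) = -u (y + t) :=
    (measurePreserving_add_right (volume : Measure ℝ) t).quasiMeasurePreserving.tendsto_ae.eventually
      huo
  calc ∫ x, (u (x + t) - u x) * conj (w (-(x + t)) - w (-x))
      = ∫ y, (u (-y + t) - u (-y)) * conj (w (-(-y + t)) - w (-(-y))) :=
        (integral_neg_eq_self
          (fun x ↦ (u (x + t) - u x) * conj (w (-(x + t)) - w (-x))) volume).symm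
    _ = ∫ y, (u (-(y + t) + t) - u (-(y + t))) * conj (w (-(-(y + t) + t)) - w (-(-(y + t)))) :=
        (integral_add_right_eq_self
          (fun y ↦ (u (-y + t) - u (-y)) * conj (w (-(-y + t)) - w (-(-y)))) t).symm
    _ = ∫ y, -((u (y + t) - u y) * conj (w (y + t) - w y)) := by
        refine integral_congr_ae ?_
        filter_upwards [huo, hut] with y h1 h2
        have e1 : -(y + t) + t = -y := by ring
        rw [e1, neg_neg, neg_neg, h1, h2, map_sub, map_sub]
        ring
    _ = -∫ x, (u (x + t) - u x) * conj (w (x + t) - w x) := integral_neg _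

/-! ### The weak Euler–Lagrange equation against all window directions -/

/-- **Weak Euler–Lagrange equation of an odd-sector ground state against EVERY finite-energy window
direction** (odd twin of `WeilWindowFlowWindowLipschitz.stub_eulerLagrange` with the conclusion's shape
unchanged): for an odd-sector ground state `u` at the window `a` and every `w ∈ L²` vanishing a.e. off
`[-a, a]` with integrable archimedean energy density — `w` NOT assumed odd — the polarised closed form
equals `ε_od(a)⟨u, w⟩`.  By reflection symmetry from the odd-direction identity
`OddSector.oddGroundState_eulerLagrange_formDomain` applied to `w − w(−·)`.
[cite: Bombieri2000Weil, §4 Lemma 1 eq. (4.2); §9 Lemma 11] -/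
theorem oddGroundState_eulerLagrange_all :
    ∀ (a : ℝ) (u : ℝ → ℂ), IsWeilOddGroundState a u →
      ∀ w : ℝ → ℂ, MemLp w 2 → (∀ᵐ x : ℝ, x ∉ Icc (-a) a → w x = 0) →
        IntegrableOn (fun t ↦ weilArchDensity t * weilIncrement w t) (Ioi 0) →
        2 * (∫ x, u x * (Real.cosh (x / 2) : ℂ)) * (starRingEnd ℂ) (∫ x, w x * (Real.cosh (x / 2) : ℂ))
          - 2 * (∫ x, u x * (Real.sinh (x / 2) : ℂ)) * (starRingEnd ℂ) (∫ x, w x * (Real.sinh (x / 2) : ℂ))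
          + (∑ n ∈ weilPrimeIndex a, (((ArithmeticFunction.vonMangoldt n : ℝ) / Real.sqrt n : ℝ) : ℂ) *
              ∫ x, (u (x + Real.log n) - u x) * (starRingEnd ℂ) (w (x + Real.log n) - w x))
          + (∫ t in Ioi (0 : ℝ), (weilArchDensity t : ℂ) *
              ∫ x, (u (x + t) - u x) * (starRingEnd ℂ) (w (x + t) - w x))
          - (weilMarkovConstant a : ℂ) * ∫ x, u x * (starRingEnd ℂ) (w x)
        = (weilOddGroundEnergy a : ℂ) * ∫ x, u x * (starRingEnd ℂ) (w x) := by
  intro a u hu w hw hw0 hfw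
  have hU : MemLp u 2 := hu.memLp
  have huo : ∀ᵐ x : ℝ, u (-x) = -u x := hu.ae_neg
  have hCu : ∫ x, u x * (Real.cosh (x / 2) : ℂ) = 0 := integral_mul_cosh_eq_zero_of_ae_odd huo
  -- the reflected direction `w(−·)` and the odd direction `v = w − w(−·)`
  have hwr : MemLp (fun x ↦ w (-x)) 2 :=
    hw.comp_measurePreserving (Measure.measurePreserving_neg volume)
  have hwr0 : ∀ᵐ x : ℝ, x ∉ Icc (-a) a → w (-x) = 0 := elAll_reflect_support hw0
  set v : ℝ → ℂ := fun x ↦ w x - w (-x) with hvdef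
  have hv : MemLp v 2 := hw.sub hwr
  have hv0 : ∀ᵐ x : ℝ, x ∉ Icc (-a) a → v x = 0 := by
    filter_upwards [hw0, hwr0] with x h1 h2 hx
    simp only [hvdef, h1 hx, h2 hx, sub_zero]
  have hvo : ∀ᵐ x : ℝ, v (-x) = -v x := Eventually.of_forall fun x ↦ by
    simp only [hvdef, neg_neg, neg_sub]
  -- finite archimedean energy of `v`: `D_t(v) ≤ 4 D_t(w)`
  have hDv : ∀ t, weilIncrement v t ≤ 4 * weilIncrement w t := by
    intro t
    have hiw := integrable_weilIncrement_integrand hw t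
    have hiwr := integrable_weilIncrement_integrand hwr t
    have hle : ∀ x, ‖v (x + t) - v x‖ ^ 2 ≤
        2 * ‖w (x + t) - w x‖ ^ 2 + 2 * ‖w (-(x + t)) - w (-x)‖ ^ 2 := by
      intro x
      have e : v (x + t) - v x = (w (x + t) - w x) - (w (-(x + t)) - w (-x)) := by
        simp only [hvdef]; ring
      rw [e]
      have h1 := norm_sub_le (w (x + t) - w x) (w (-(x + t)) - w (-x))
      have h2 : ‖(w (x + t) - w x) - (w (-(x + t)) - w (-x))‖ ^ 2 ≤
          (‖w (x + t) - w x‖ + ‖w (-(x + t)) - w (-x)‖) ^ 2 :=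
        pow_le_pow_left₀ (norm_nonneg _) h1 2
      nlinarith [h2, sq_nonneg (‖w (x + t) - w x‖ - ‖w (-(x + t)) - w (-x)‖)]
    calc weilIncrement v t = ∫ x, ‖v (x + t) - v x‖ ^ 2 := rfl
      _ ≤ ∫ x, (2 * ‖w (x + t) - w x‖ ^ 2 + 2 * ‖w (-(x + t)) - w (-x)‖ ^ 2) :=
          integral_mono_of_nonneg (Eventually.of_forall fun x ↦ by positivity)
            ((hiw.const_mul 2).add (hiwr.const_mul 2)) (Eventually.of_forall hle)
      _ = 2 * weilIncrement w t + 2 * weilIncrement (fun x ↦ w (-x)) t := by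
          rw [integral_add (hiw.const_mul 2) (hiwr.const_mul 2), integral_const_mul,
            integral_const_mul]
          rfl
      _ = 4 * weilIncrement w t := by rw [weilIncrement_comp_neg]; ring
  have hfv : IntegrableOn (fun t ↦ weilArchDensity t * weilIncrement v t) (Ioi 0) := by
    have hm : AEStronglyMeasurable (fun t ↦ weilArchDensity t * weilIncrement v t)
        (volume.restrict (Ioi 0)) :=
      (elAll_measurable_weilArchDensity.aestronglyMeasurable.mul (elAll_aesm_weilIncrement hv.1)).restrict
    refine Integrable.mono' (hfw.const_mul 4) hm ?_
    refine (ae_restrict_iff' measurableSet_Ioi).2 (Eventually.of_forall fun t (ht : 0 < t) ↦ ?_)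
    have hρ := (weilArchDensity_pos ht).le
    rw [Real.norm_of_nonneg (mul_nonneg hρ (weilIncrement_nonneg _ _))]
    have := mul_le_mul_of_nonneg_left (hDv t) hρ
    show weilArchDensity t * weilIncrement v t ≤ 4 * (weilArchDensity t * weilIncrement w t)
    linarith
  -- the odd identity for `v`
  have hEL := oddGroundState_eulerLagrange_formDomain a u hu v hv hv0 hvo hfv
  -- termwise: every term of `B(u, v)` is twice the term of `B(u, w)`
  have hφs : Continuous fun x : ℝ ↦ (Real.sinh (x / 2) : ℂ) :=
    Complex.continuous_ofReal.comp (Real.continuous_sinh.comp (continuous_id.div_const 2))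
  have hws : Integrable fun x ↦ w x * (Real.sinh (x / 2) : ℂ) :=
    elAll_integrable_mul_continuous hw hw0 hφs
  have hwrs : Integrable fun x ↦ w (-x) * (Real.sinh (x / 2) : ℂ) :=
    elAll_integrable_mul_continuous hwr hwr0 hφs
  have e1 : ∫ x, v x * (Real.sinh (x / 2) : ℂ) = 2 * ∫ x, w x * (Real.sinh (x / 2) : ℂ) := by
    have : (fun x ↦ v x * (Real.sinh (x / 2) : ℂ)) =
        fun x ↦ w x * (Real.sinh (x / 2) : ℂ) - w (-x) * (Real.sinh (x / 2) : ℂ) := by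
      funext x; simp only [hvdef]; ring
    rw [this, integral_sub hws hwrs, elAll_sinh_reflect w]
    ring
  have e2 : ∀ t : ℝ, ∫ x, (u (x + t) - u x) * conj (v (x + t) - v x) =
      2 * ∫ x, (u (x + t) - u x) * conj (w (x + t) - w x) := by
    intro t
    have hi1 := elAll_integrable_cross hU hw t
    have hi2 := elAll_integrable_cross hU hwr t
    have : (fun x ↦ (u (x + t) - u x) * conj (v (x + t) - v x)) =
        fun x ↦ (u (x + t) - u x) * conj (w (x + t) - w x) -
          (u (x + t) - u x) * conj (w (-(x + t)) - w (-x)) := by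
      funext x
      simp only [hvdef, map_sub]
      ring
    rw [this, integral_sub hi1 hi2, elAll_cross_reflect huo t]
    ring
  have e3 : ∫ x, u x * conj (v x) = 2 * ∫ x, u x * conj (w x) := by
    have hi1 : Integrable fun x ↦ u x * conj (w x) :=
      hU.integrable_mul (ConnesVanSuijlekom.memLp_conj hw)
    have hi2 : Integrable fun x ↦ u x * conj (w (-x)) :=
      hU.integrable_mul (ConnesVanSuijlekom.memLp_conj hwr)
    have : (fun x ↦ u x * conj (v x)) = fun x ↦ u x * conj (w x) - u x * conj (w (-x)) := by
      funext x
      simp only [hvdef, map_sub]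
      ring
    rw [this, integral_sub hi1 hi2, elAll_inner_reflect huo]
    ring
  have e4 : (∑ n ∈ weilPrimeIndex a,
      (((ArithmeticFunction.vonMangoldt n : ℝ) / Real.sqrt n : ℝ) : ℂ) *
        ∫ x, (u (x + Real.log n) - u x) * conj (v (x + Real.log n) - v x)) =
      2 * ∑ n ∈ weilPrimeIndex a,
        (((ArithmeticFunction.vonMangoldt n : ℝ) / Real.sqrt n : ℝ) : ℂ) *
          ∫ x, (u (x + Real.log n) - u x) * conj (w (x + Real.log n) - w x) := by
    rw [Finset.mul_sum]
    refine Finset.sum_congr rfl fun n _ ↦ ?_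
    rw [e2 (Real.log n)]
    ring
  have e5 : (∫ t in Ioi (0 : ℝ), (weilArchDensity t : ℂ) *
      ∫ x, (u (x + t) - u x) * conj (v (x + t) - v x)) =
      2 * ∫ t in Ioi (0 : ℝ), (weilArchDensity t : ℂ) *
        ∫ x, (u (x + t) - u x) * conj (w (x + t) - w x) := by
    have : (fun t ↦ (weilArchDensity t : ℂ) * ∫ x, (u (x + t) - u x) * conj (v (x + t) - v x)) =
        fun t ↦ (2 : ℂ) * ((weilArchDensity t : ℂ) *
          ∫ x, (u (x + t) - u x) * conj (w (x + t) - w x)) := by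
      funext t
      rw [e2 t]
      ring
    rw [this, integral_const_mul]
  rw [hCu, e1, e3, e4, e5, map_mul, map_ofNat] at hEL
  rw [hCu]
  linear_combination (1 / 2 : ℂ) * hEL

end Summit.RiemannHypothesis.RiemannHypothesis.Theorems.OddSectorWindowLipschitz

end
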